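import Mathlib.NumberTheory.Zsqrtd.Basic
import Mathlib.LinearAlgebra.Matrix.ConjTranspose
import Mathlib.LinearAlgebra.Matrix.Notation
import Mathlib.LinearAlgebra.Matrix.Determinant.Basic
import Mathlib.Tactic.Ring
import Mathlib.Tactic.LinearCombination
import Mathlib.Tactic.Linarith
import HarnessLib

/-!
# Venture HSemireg — the anti-unitary pair matrix `U_m` of a real node field (ENGINE-W PROBE5 §18, THEOREM
# REAL-COMPLETE (a): the factor-MIXING mechanism) and its absence for imaginary node fields (§16) — kernel algebra

HONEST FRAMING. Lean index of the computation cell `pub-hsemireg`, widening group ENGINE-W (code A, seat `engine-w-1`,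
gen 17). RING ALGEBRA of one `2 × 2` matrix over a commutative ring with involution, and integer arithmetic in `ℤ[√m]`
(Mathlib's `ℤ√m`); no abelian variety, sheaf, `Ext` group, secant structure or semiregularity map is constructed; nothing
here says that HC, HC_CM or HC_AV holds. Theorems only (0 `def`, 0 named fact, 0 `sorry`).

SOURCE (the cell's own result): `widen/ENGINE-W/out/probe5/PROBE5-STIZ-A.md` §18 (v2.4, engine-w-1 g6; «THE PAIR MATRIX»)
and §16 (v2.2, THEOREM NO-MIX, the imaginary contrast); machine leg `codeA/umatrix_A.py` → `out/probe5/umatrix.A.json`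
`078cdc3d81bdee1b` (30 real fields). §18 as printed: «For real `m` let `x, y ∈ ℤ[√m]` with **`N(x) + N(y) = −1`** … and put
**`U_m := [[x, −ȳ],[y, x̄]] ∈ GL₂(ℤ[√m])`** (`ȳ` = conjugate): then `U*U = −I` for the form `⟨u,v⟩ = Σ u_i τ(v_i)` and
`det U = −1` … CONSEQUENCE: if two target factors `a, b` are ANTI-isometric to the seed factor (`N(x_a)h_a = −h_s`, likewise
`b` — «`ε = −1`» factors), then **`M_{ab} := diag(x_a, x_b)·U_m`** is an integral `K`-linear isometry
`(h_s ⊕ h_s) → (h_a ⊕ h_b)` … (`⟨Mu,Mu⟩′ = Σ h_c N(x_c) N((Uu)_c) = −h_s⟨Uu,Uu⟩ = h_s⟨u,u⟩`). This is the mixing mechanism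
behind every pair found by the solver.» and «with a unit `u` of norm `−1` take `x = u, y = 0`». §16 (imaginary node fields
`m < 0`): «(P) POSITIVITY … for `m < 0` each `N(M_ij)` … is `0` or totally positive» — so no such `U` exists there («Factor-
mixing is a REAL-node-field phenomenon»). What the kernel holds (every model fact enters BY VALUE through these quotations):

* §1 (any commutative ring `R` with an involution `star`, e.g. `R = ℤ[√m]`, `star = τ`): **`pair_conjTranspose_mul`**
  `Uᴴ·U = −1`, `pair_mul_conjTranspose` `U·Uᴴ = −1`, **`pair_det`** `det U = −1` (so `U ∈ GL₂`: `pair_det_isUnit`), for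
  `U = [[x, −star y],[y, star x]]` under `x·star x + y·star y = −1`.
* §2 `form_reversed_of_conjTranspose_mul` — ANY `n × n` matrix with `Uᴴ U = −1` reverses the standard `star`-sesquilinear
  form: `⟨Uu, Uv⟩ = −⟨u, v⟩` (`⟨u,v⟩ = Σ u_i · star v_i`); `pair_form_reversed` — the same for `U_m` written out in coordinates.
* §3 **`mixing_transport`** — the CONSEQUENCE: with `h_a·N(x_a) = −h_s = h_b·N(x_b)` the map `M = diag(x_a, x_b)·U_m` satisfies
  `h_a·N((Mu)_a) + h_b·N((Mu)_b) = h_s·(N(u₁) + N(u₂))` and its polarised form `mixing_transport_polar` (an isometry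
  `(R², h_s ⊕ h_s) → (R², h_a ⊕ h_b)` of `star`-hermitian forms).
* §4 (`ℤ√d`, Mathlib): `norm_add_norm_eq_neg_one_iff` (the hypothesis of §1 ⟺ `N(x) + N(y) = −1`); **`no_pair_matrix_of_nonpos`**
  — for `d ≤ 0` NO `2 × 2` matrix over `ℤ√d` has `Uᴴ U = −1` (its `(0,0)` entry is `N(U₀₀) + N(U₁₀) ≥ 0`): the imaginary
  contrast of §16; `unit_witness` (`N(u) = −1 ⇒ (x, y) = (u, 0)`); `sum_two_squares_family` (`m = a² + b² + 1 ⇒ x = a + √m`,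
  `y = b`); and **`umatrix_table`** — the 30 witnesses `(x, y)` of `umatrix.A.json` for every squarefree `2 ≤ m ≤ 47`, by `decide`.
WHAT IS NOT HERE: THEOREM REAL-COMPLETE itself (the assembled `Φ` on `E_ω⁶ × Ê`, LEMMA ID4∕W, class-exactness), THEOREM
NO-MIX (the volume law and the monomiality argument), the sign rule. Tier of the source: hand ×1 (A) + machine ×1 (A).
-/

namespace Summit.Ventures.HSemireg.PairMatrix

open Matrix

/-! ## §1 The pair matrix `U = [[x, −ȳ],[y, x̄]]` over a commutative ring with involution -/

/-- **§18 «`U*U = −I`»**: over any commutative ring with involution, `x·x̄ + y·ȳ = −1` implies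
`[[x, −ȳ],[y, x̄]]ᴴ · [[x, −ȳ],[y, x̄]] = −1`. [kernel] -/
theorem pair_conjTranspose_mul {R : Type*} [CommRing R] [StarRing R] (x y : R)
    (h : x * star x + y * star y = -1) :
    (!![x, -star y; y, star x])ᴴ * !![x, -star y; y, star x] = -1 := by
  ext i j
  fin_cases i <;> fin_cases j <;>
    simp [Matrix.mul_apply, Fin.sum_univ_two, Matrix.conjTranspose_apply] <;>
    first | ring1 | linear_combination h

/-- The other order: `U · Uᴴ = −1` as well. [kernel] -/
theorem pair_mul_conjTranspose {R : Type*} [CommRing R] [StarRing R] (x y : R)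
    (h : x * star x + y * star y = -1) :
    !![x, -star y; y, star x] * (!![x, -star y; y, star x])ᴴ = -1 := by
  ext i j
  fin_cases i <;> fin_cases j <;>
    simp [Matrix.mul_apply, Fin.sum_univ_two, Matrix.conjTranspose_apply] <;>
    first | ring1 | linear_combination h

/-- **§18 «`det U = −1`»**: `det [[x, −ȳ],[y, x̄]] = x·x̄ + y·ȳ = −1`. [kernel] -/
theorem pair_det {R : Type*} [CommRing R] [StarRing R] (x y : R) (h : x * star x + y * star y = -1) :
    Matrix.det !![x, -star y; y, star x] = -1 := by
  rw [Matrix.det_fin_two_of]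
  linear_combination h

/-- Hence `U ∈ GL₂(R)` («`U_m ∈ GL₂(ℤ[√m])`»): its determinant is a unit. [kernel] -/
theorem pair_det_isUnit {R : Type*} [CommRing R] [StarRing R] (x y : R) (h : x * star x + y * star y = -1) :
    IsUnit (Matrix.det !![x, -star y; y, star x]) := by
  rw [pair_det x y h]
  exact isUnit_one.neg

/-! ## §2 A matrix with `Uᴴ U = −1` reverses the standard sesquilinear form -/

/-- For ANY square matrix `U` with `Uᴴ·U = −1` (any size, any commutative `star`-ring): `⟨Uu, Uv⟩ = −⟨u, v⟩` for the form
`⟨u, v⟩ = Σ_i u_i · star v_i` — written with Mathlib's `dotProduct`: `(U u) ⬝ star (U v) = −(u ⬝ star v)`. [kernel] -/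
theorem form_reversed_of_conjTranspose_mul {R : Type*} [CommRing R] [StarRing R] {n : Type*} [Fintype n]
    [DecidableEq n] (U : Matrix n n R) (hU : Uᴴ * U = -1) (u v : n → R) :
    (U *ᵥ u) ⬝ᵥ star (U *ᵥ v) = -(u ⬝ᵥ star v) := by
  rw [Matrix.star_mulVec, dotProduct_comm, Matrix.dotProduct_mulVec, Matrix.vecMul_vecMul, hU,
    Matrix.vecMul_neg, Matrix.vecMul_one, neg_dotProduct, dotProduct_comm]

/-- §2 for the pair matrix, in coordinates: `(Uu)₁ = x u₁ − ȳ u₂`, `(Uu)₂ = y u₁ + x̄ u₂`, and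
`(Uu)₁·star((Uv)₁) + (Uu)₂·star((Uv)₂) = −(u₁·star v₁ + u₂·star v₂)`. [kernel] -/
theorem pair_form_reversed {R : Type*} [CommRing R] [StarRing R] (x y : R) (h : x * star x + y * star y = -1)
    (u₁ u₂ v₁ v₂ : R) :
    (x * u₁ - star y * u₂) * star (x * v₁ - star y * v₂) + (y * u₁ + star x * u₂) * star (y * v₁ + star x * v₂)
      = -(u₁ * star v₁ + u₂ * star v₂) := by
  simp only [star_sub, star_add, star_mul', star_star]
  linear_combination (u₁ * star v₁ + u₂ * star v₂) * h

/-! ## §3 The CONSEQUENCE: `M = diag(x_a, x_b)·U` is an isometry `(h_s ⊕ h_s) → (h_a ⊕ h_b)` for two `ε = −1` factors -/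

/-- **§18 CONSEQUENCE** («`⟨Mu,Mu⟩′ = Σ h_c N(x_c) N((Uu)_c) = −h_s⟨Uu,Uu⟩ = h_s⟨u,u⟩`»): if `h_a·(x_a x̄_a) = −h_s` and
`h_b·(x_b x̄_b) = −h_s` (both target factors ANTI-isometric to the seed factor) and `x x̄ + y ȳ = −1`, then for
`(Mu)_a = x_a (x u₁ − ȳ u₂)`, `(Mu)_b = x_b (y u₁ + x̄ u₂)`:
`h_a·(Mu)_a·star((Mu)_a) + h_b·(Mu)_b·star((Mu)_b) = h_s·(u₁ ū₁ + u₂ ū₂)`. [kernel] -/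
theorem mixing_transport {R : Type*} [CommRing R] [StarRing R] (x y xa xb ha hb hs : R)
    (h : x * star x + y * star y = -1) (hxa : ha * (xa * star xa) = -hs) (hxb : hb * (xb * star xb) = -hs)
    (u₁ u₂ : R) :
    ha * ((xa * (x * u₁ - star y * u₂)) * star (xa * (x * u₁ - star y * u₂)))
      + hb * ((xb * (y * u₁ + star x * u₂)) * star (xb * (y * u₁ + star x * u₂)))
      = hs * (u₁ * star u₁ + u₂ * star u₂) := by
  simp only [star_sub, star_add, star_mul', star_star]
  linear_combination ((x * u₁ - star y * u₂) * (star x * star u₁ - y * star u₂)) * hxa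
    + ((y * u₁ + star x * u₂) * (star y * star u₁ + x * star u₂)) * hxb
    - hs * (u₁ * star u₁ + u₂ * star u₂) * h

/-- Polarised form of `mixing_transport`: `h_a·(Mu)_a·star((Mv)_a) + h_b·(Mu)_b·star((Mv)_b) = h_s·(u₁ v̄₁ + u₂ v̄₂)` — `M` is an
isometry of the `star`-hermitian forms `h_s ⊕ h_s → h_a ⊕ h_b` on `R²`. [kernel] -/
theorem mixing_transport_polar {R : Type*} [CommRing R] [StarRing R] (x y xa xb ha hb hs : R)
    (h : x * star x + y * star y = -1) (hxa : ha * (xa * star xa) = -hs) (hxb : hb * (xb * star xb) = -hs)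
    (u₁ u₂ v₁ v₂ : R) :
    ha * ((xa * (x * u₁ - star y * u₂)) * star (xa * (x * v₁ - star y * v₂)))
      + hb * ((xb * (y * u₁ + star x * u₂)) * star (xb * (y * v₁ + star x * v₂)))
      = hs * (u₁ * star v₁ + u₂ * star v₂) := by
  simp only [star_sub, star_add, star_mul', star_star]
  linear_combination ((x * u₁ - star y * u₂) * (star x * star v₁ - y * star v₂)) * hxa
    + ((y * u₁ + star x * u₂) * (star y * star v₁ + x * star v₂)) * hxb
    - hs * (u₁ * star v₁ + u₂ * star v₂) * h

/-! ## §4 Over `ℤ[√d]` (Mathlib `ℤ√d`): the hypothesis as a norm equation, the imaginary contrast, witnesses -/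

/-- In `ℤ√d` the hypothesis of §1 reads `N(x) + N(y) = −1` (`N(z) = z·z̄`, `Zsqrtd.norm`). [kernel] -/
theorem norm_add_norm_eq_neg_one_iff {d : ℤ} (x y : ℤ√d) :
    x * star x + y * star y = -1 ↔ x.norm + y.norm = -1 := by
  rw [← Zsqrtd.norm_eq_mul_conj, ← Zsqrtd.norm_eq_mul_conj]
  constructor
  · intro h
    have := congrArg Zsqrtd.re h
    simpa using this
  · intro h
    ext <;> simp [h]

/-- **The imaginary contrast (§16)**: for `d ≤ 0` norms are non-negative, so `N(x) + N(y) = −1` has no solution … [kernel] -/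
theorem norm_add_norm_ne_neg_one {d : ℤ} (hd : d ≤ 0) (x y : ℤ√d) : x.norm + y.norm ≠ -1 := by
  have hx := Zsqrtd.norm_nonneg hd x
  have hy := Zsqrtd.norm_nonneg hd y
  omega

/-- … and NO `2 × 2` matrix `U` over `ℤ√d`, `d ≤ 0`, satisfies `Uᴴ·U = −1`: the `(0,0)` entry of `Uᴴ U` is
`N(U₀₀) + N(U₁₀) ≥ 0` («for `m < 0` each `N(M_ij)` is `0` or totally positive»; factor-mixing is a real-field phenomenon). [kernel] -/
theorem no_pair_matrix_of_nonpos {d : ℤ} (hd : d ≤ 0) (U : Matrix (Fin 2) (Fin 2) (ℤ√d)) : Uᴴ * U ≠ -1 := by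
  intro hU
  have h00 := congrFun (congrFun hU 0) 0
  simp [Matrix.mul_apply, Fin.sum_univ_two, Matrix.conjTranspose_apply] at h00
  have key : U 0 0 * star (U 0 0) + U 1 0 * star (U 1 0) = -1 := by
    linear_combination h00
  exact norm_add_norm_ne_neg_one hd (U 0 0) (U 1 0) ((norm_add_norm_eq_neg_one_iff _ _).1 key)

/-- §18 «with a unit `u` of norm `−1` take `x = u, y = 0`». [kernel] -/
theorem unit_witness {d : ℤ} (u : ℤ√d) (hu : u.norm = -1) : u.norm + (0 : ℤ√d).norm = -1 := by
  simp [Zsqrtd.norm_def] at hu ⊢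
  linarith

/-- A witness family: if `m = a² + b² + 1` then `x = a + √m`, `y = b` has `N(x) + N(y) = (a² − m) + b² = −1`
(e.g. `m = 2, 3, 5, 6, 10, 11, 14, 17, 19, 21, 26, 30, 35, 37, 38, …`). [kernel] -/
theorem sum_two_squares_family (a b m : ℤ) (hm : m = a ^ 2 + b ^ 2 + 1) :
    (⟨a, 1⟩ : ℤ√m).norm + (⟨b, 0⟩ : ℤ√m).norm = -1 := by
  simp only [Zsqrtd.norm_def]
  rw [hm]
  ring

/-- **The `U_m` table of `umatrix.A.json` `078cdc3d81bdee1b`** (all 30 squarefree `2 ≤ m ≤ 47`; `⟨x₁, x₂⟩ = x₁ + x₂√m`):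
`N(x) + N(y) = −1` for `(m; x, y)` = `(2; √2, 1)`, `(3; 1+√3, 1)`, `(5; √5, 2)`, `(6; 1+√6, 2)`, `(7; 2+√7, 3+√7)`, `(10; √10, 3)`,
`(11; 1+√11, 3)`, `(13; √13, 5+√13)`, `(14; 2+√14, 3)`, `(15; 2+√15, 5+√15)`, `(17; √17, 4)`, `(19; 3+√19, 3)`, `(21; 2+√21, 4)`,
`(22; 3+2√22, 10+√22)`, `(23; 3+√23, 6+√23)`, `(26; √26, 5)`, `(29; 2√29, 12+√29)`, `(30; 2+√30, 5)`, `(31; 5+√31, 6+√31)`,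
`(33; 4+√33, 4)`, `(34; 2√34, 13+√34)`, `(35; 3+√35, 5)`, `(37; √37, 6)`, `(38; 1+√38, 6)`, `(39; 5+2√39, 13+√39)`, `(41; 2+√41, 6)`,
`(42; 4+√42, 5)`, `(43; 2+√43, 9+√43)`, `(46; 3+√46, 6)`, `(47; 3+2√47, 15+√47)`. [kernel, `decide`] -/
theorem umatrix_table :
    (⟨0, 1⟩ : ℤ√2).norm + (⟨1, 0⟩ : ℤ√2).norm = -1 ∧ (⟨1, 1⟩ : ℤ√3).norm + (⟨1, 0⟩ : ℤ√3).norm = -1 ∧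
    (⟨0, 1⟩ : ℤ√5).norm + (⟨2, 0⟩ : ℤ√5).norm = -1 ∧ (⟨1, 1⟩ : ℤ√6).norm + (⟨2, 0⟩ : ℤ√6).norm = -1 ∧
    (⟨2, 1⟩ : ℤ√7).norm + (⟨3, 1⟩ : ℤ√7).norm = -1 ∧ (⟨0, 1⟩ : ℤ√10).norm + (⟨3, 0⟩ : ℤ√10).norm = -1 ∧
    (⟨1, 1⟩ : ℤ√11).norm + (⟨3, 0⟩ : ℤ√11).norm = -1 ∧ (⟨0, 1⟩ : ℤ√13).norm + (⟨5, 1⟩ : ℤ√13).norm = -1 ∧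
    (⟨2, 1⟩ : ℤ√14).norm + (⟨3, 0⟩ : ℤ√14).norm = -1 ∧ (⟨2, 1⟩ : ℤ√15).norm + (⟨5, 1⟩ : ℤ√15).norm = -1 ∧
    (⟨0, 1⟩ : ℤ√17).norm + (⟨4, 0⟩ : ℤ√17).norm = -1 ∧ (⟨3, 1⟩ : ℤ√19).norm + (⟨3, 0⟩ : ℤ√19).norm = -1 ∧
    (⟨2, 1⟩ : ℤ√21).norm + (⟨4, 0⟩ : ℤ√21).norm = -1 ∧ (⟨3, 2⟩ : ℤ√22).norm + (⟨10, 1⟩ : ℤ√22).norm = -1 ∧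
    (⟨3, 1⟩ : ℤ√23).norm + (⟨6, 1⟩ : ℤ√23).norm = -1 ∧ (⟨0, 1⟩ : ℤ√26).norm + (⟨5, 0⟩ : ℤ√26).norm = -1 ∧
    (⟨0, 2⟩ : ℤ√29).norm + (⟨12, 1⟩ : ℤ√29).norm = -1 ∧ (⟨2, 1⟩ : ℤ√30).norm + (⟨5, 0⟩ : ℤ√30).norm = -1 ∧
    (⟨5, 1⟩ : ℤ√31).norm + (⟨6, 1⟩ : ℤ√31).norm = -1 ∧ (⟨4, 1⟩ : ℤ√33).norm + (⟨4, 0⟩ : ℤ√33).norm = -1 ∧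
    (⟨0, 2⟩ : ℤ√34).norm + (⟨13, 1⟩ : ℤ√34).norm = -1 ∧ (⟨3, 1⟩ : ℤ√35).norm + (⟨5, 0⟩ : ℤ√35).norm = -1 ∧
    (⟨0, 1⟩ : ℤ√37).norm + (⟨6, 0⟩ : ℤ√37).norm = -1 ∧ (⟨1, 1⟩ : ℤ√38).norm + (⟨6, 0⟩ : ℤ√38).norm = -1 ∧
    (⟨5, 2⟩ : ℤ√39).norm + (⟨13, 1⟩ : ℤ√39).norm = -1 ∧ (⟨2, 1⟩ : ℤ√41).norm + (⟨6, 0⟩ : ℤ√41).norm = -1 ∧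
    (⟨4, 1⟩ : ℤ√42).norm + (⟨5, 0⟩ : ℤ√42).norm = -1 ∧ (⟨2, 1⟩ : ℤ√43).norm + (⟨9, 1⟩ : ℤ√43).norm = -1 ∧
    (⟨3, 1⟩ : ℤ√46).norm + (⟨6, 0⟩ : ℤ√46).norm = -1 ∧ (⟨3, 2⟩ : ℤ√47).norm + (⟨15, 1⟩ : ℤ√47).norm = -1 := by
  simp only [Zsqrtd.norm_def]
  decide

/-- The units of norm `−1` recorded in the same table (`unit_norm_minus1`): `1+√2`, `2+√5`, `3+√10`, `18+5√13`, `4+√17`,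
`5+√26`, `70+13√29`, `6+√37`, `32+5√41` — each gives the diagonal pair matrix `U = u·I` (`x = u`, `y = 0`). [kernel, `decide`] -/
theorem unit_norm_neg_one_table :
    (⟨1, 1⟩ : ℤ√2).norm = -1 ∧ (⟨2, 1⟩ : ℤ√5).norm = -1 ∧ (⟨3, 1⟩ : ℤ√10).norm = -1 ∧ (⟨18, 5⟩ : ℤ√13).norm = -1 ∧
    (⟨4, 1⟩ : ℤ√17).norm = -1 ∧ (⟨5, 1⟩ : ℤ√26).norm = -1 ∧ (⟨70, 13⟩ : ℤ√29).norm = -1 ∧ (⟨6, 1⟩ : ℤ√37).norm = -1 ∧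
    (⟨32, 5⟩ : ℤ√41).norm = -1 := by
  simp only [Zsqrtd.norm_def]
  decide

/-- The concrete pair matrix at `m = 3` (the card's first example, `x = 1 + √3`, `y = 1`): `U₃ᴴ·U₃ = −1` and `det U₃ = −1`
in `ℤ√3` — §1 instantiated through `norm_add_norm_eq_neg_one_iff`. [kernel] -/
theorem pair_matrix_sqrt_three :
    (!![(⟨1, 1⟩ : ℤ√3), -star (⟨1, 0⟩ : ℤ√3); ⟨1, 0⟩, star ⟨1, 1⟩])ᴴ * !![(⟨1, 1⟩ : ℤ√3), -star (⟨1, 0⟩ : ℤ√3); ⟨1, 0⟩, star ⟨1, 1⟩]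
        = -1 ∧
      Matrix.det !![(⟨1, 1⟩ : ℤ√3), -star (⟨1, 0⟩ : ℤ√3); ⟨1, 0⟩, star ⟨1, 1⟩] = -1 := by
  have h : (⟨1, 1⟩ : ℤ√3) * star (⟨1, 1⟩ : ℤ√3) + ⟨1, 0⟩ * star ⟨1, 0⟩ = -1 :=
    (norm_add_norm_eq_neg_one_iff _ _).2 (by simp only [Zsqrtd.norm_def]; decide)
  exact ⟨pair_conjTranspose_mul _ _ h, pair_det _ _ h⟩

end Summit.Ventures.HSemireg.PairMatrix
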